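import Literature.Probability.LatticeModels.BesselSaddleInterpolation
import Mathlib.Analysis.RCLike.Sqrt
import Mathlib.Analysis.SpecialFunctions.Complex.LogDeriv
import Mathlib.Analysis.SpecialFunctions.Pow.Deriv
import Mathlib.Analysis.Calculus.ParametricIntervalIntegral
import HarnessLib

/-!
# The complex-analytic extension of the Bessel interpolation to the strip `|Im φ| < β`
# (FS81 App. B: "`I_β(φ)`, defined for all `φ` in the strip `|Im φ| ≤ β/2`")

Support file of the proof programme of the named fact
`Literature.MathematicalPhysics.QuantumFieldTheory.FrohlichSpencerU1PerimeterLawD4` (Wilson-action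
step, FS82 p. 433 / FS81 §6 and Appendix B). `BesselSaddleInterpolation` defines, for real `φ`,
`besselInterp β φ = exp(F_β(φ)) · amp β φ` with `F_β(φ) = √(β² + φ²) - φ arsinh(φ/β)` and
`amp β φ = (2π)⁻¹ ∫_{-π}^{π} e^{-√(β²+φ²)(1 - cos θ)} cos(φ(θ - sin θ)) dθ`. FS81 §6 requires `I_β`
to be "complex analytic and non-zero in the strip `|Im φ| ≤ β/2`" (p. 576) with the translation
bounds (c), (d). This file constructs the analytic continuation with principal branches,

* `bigBC β z = √(β² + z²)` (`Complex.sqrt`), `saddleRC β z = log((z + √(β² + z²))/β)` (`= arsinh(z/β)`),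
  `expoC β z = √(β² + z²) - z · saddleRC β z`, `ampC β z` (the same parametric integral with
  complex `z`), `besselInterpC β z = exp(expoC β z) · ampC β z`,

and proves: on the strip `|Im z| < β` the radicand `β² + z²` has positive real part (so all branches
are the principal analytic ones), `Re √(β² + z²) > 0`, `Re (z + √(β² + z²)) > 0`; the values on the
real axis are the real objects (`bigBC_ofReal`, `saddleRC_ofReal`, `expoC_ofReal`, `ampC_ofReal`,
**`besselInterpC_ofReal : besselInterpC β x = besselInterp β x`**); the complex derivatives
`S' = z/S`, `τ' = 1/S`, **`F' = -τ`**, `F'' = -1/S` (`hasDerivAt_bigBC`, `hasDerivAt_saddleRC`,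
`hasDerivAt_expoC`); the elementary bounds `‖cos w‖, ‖sin w‖ ≤ e^{|Im w|}`, `‖e^{-S(z)u}‖ ≤ 1`,
`‖S(z)‖² ≥ β² - (Im z)²`; differentiation of `ampC` under the integral sign (`hasDerivAt_ampC`, with
the derivative integrand `ampIntegrandCD1`, dominated by a constant on a small disc), and hence
**analyticity of `besselInterpC` on the whole strip `|Im z| < β`** (`differentiableOn_besselInterpC`,
`analyticOnNhd_besselInterpC`). The translation bound (c) on a sub-strip is the object of the sequel.

Everything is proved; no named fact is introduced.

## References

* J. Fröhlich, T. Spencer, Comm. Math. Phys. 81 (1981) 527–602, §6 p. 576 (analyticity of `I_β` in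
  the strip), Appendix B (B.11)–(B.14). [FrohlichSpencerKT1981]
* J. Fröhlich, T. Spencer, Comm. Math. Phys. 83 (1982) 411–454, p. 433. [FrohlichSpencerCMP1982]
-/

noncomputable section

open MeasureTheory Real Filter intervalIntegral Set Complex
open scoped Topology ComplexConjugate

namespace Literature.Probability.LatticeModels

namespace BesselInterp

/-! ### The complex saddle functions -/

/-- `S(z) = √(β² + z²)`, principal branch. [cite: FrohlichSpencerKT1981, App. B (B.12)] -/
def bigBC (β : ℝ) (z : ℂ) : ℂ := Complex.sqrt ((β : ℂ) ^ 2 + z ^ 2)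

/-- `τ(z) = log((z + S(z))/β) = arsinh(z/β)`, principal branch. [cite: FrohlichSpencerKT1981, App. B (B.2)] -/
def saddleRC (β : ℝ) (z : ℂ) : ℂ := Complex.log ((z + bigBC β z) / β)

/-- The complex saddle exponent `F_β(z) = S(z) - z τ(z)`. [cite: FrohlichSpencerKT1981, App. B (B.12)] -/
def expoC (β : ℝ) (z : ℂ) : ℂ := bigBC β z - z * saddleRC β z

/-- The complex amplitude integrand `e^{-S(z)(1 - cos θ)} cos(z(θ - sin θ))`. [cite: FrohlichSpencerKT1981, App. B (B.4)] -/
def ampIntegrandC (β : ℝ) (z : ℂ) (θ : ℝ) : ℂ :=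
  Complex.exp (-(bigBC β z) * ((1 - Real.cos θ : ℝ) : ℂ)) * Complex.cos (z * ((θ - Real.sin θ : ℝ) : ℂ))

/-- The complex amplitude `ampC β z = (2π)⁻¹ ∫_{-π}^{π} e^{-S(z)(1 - cos θ)} cos(z(θ - sin θ)) dθ`.
[cite: FrohlichSpencerKT1981, App. B (B.4)–(B.10)] -/
def ampC (β : ℝ) (z : ℂ) : ℂ := ((2 * π : ℝ) : ℂ)⁻¹ * ∫ θ in (-π)..π, ampIntegrandC β z θ

/-- **The analytic continuation of the Bessel interpolation**, `I_β(z) = exp(F_β(z)) · ampC β z`.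
[cite: FrohlichSpencerKT1981, §6 p. 576 and App. B (B.14)] -/
def besselInterpC (β : ℝ) (z : ℂ) : ℂ := Complex.exp (expoC β z) * ampC β z

/-! ### The radicand on the strip `|Im z| < β` -/

/-- `Re(β² + z²) = β² + (Re z)² - (Im z)²`. [folklore] -/
theorem re_radicand (β : ℝ) (z : ℂ) : ((β : ℂ) ^ 2 + z ^ 2).re = β ^ 2 + z.re ^ 2 - z.im ^ 2 := by
  simp [sq, Complex.add_re, Complex.mul_re]; ring

/-- `Im(β² + z²) = 2 Re z Im z`. [folklore] -/
theorem im_radicand (β : ℝ) (z : ℂ) : ((β : ℂ) ^ 2 + z ^ 2).im = 2 * z.re * z.im := by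
  simp [sq, Complex.add_im, Complex.mul_im]; ring

/-- On the strip the radicand has positive real part. [folklore] -/
theorem re_radicand_pos {β : ℝ} {z : ℂ} (hz : |z.im| < β) : 0 < ((β : ℂ) ^ 2 + z ^ 2).re := by
  rw [re_radicand]
  have h1 : z.im ^ 2 < β ^ 2 := by
    have hβ : 0 < β := (abs_nonneg _).trans_lt hz
    calc z.im ^ 2 = |z.im| ^ 2 := (sq_abs _).symm
      _ < β ^ 2 := pow_lt_pow_left₀ hz (abs_nonneg _) two_ne_zero
  nlinarith [sq_nonneg z.re]

/-- On the strip the radicand lies in the slit plane. [folklore] -/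
theorem radicand_mem_slitPlane {β : ℝ} {z : ℂ} (hz : |z.im| < β) : (β : ℂ) ^ 2 + z ^ 2 ∈ slitPlane :=
  Or.inl (re_radicand_pos hz)

/-- On the strip the radicand is non-zero. [folklore] -/
theorem radicand_ne_zero {β : ℝ} {z : ℂ} (hz : |z.im| < β) : (β : ℂ) ^ 2 + z ^ 2 ≠ 0 :=
  slitPlane_ne_zero (radicand_mem_slitPlane hz)

/-! ### The complex square root -/

/-- `(√w)² = w`. [folklore] -/
theorem sqrt_sq_eq (w : ℂ) : Complex.sqrt w ^ 2 = w := by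
  rw [Complex.sqrt]
  have h := Complex.cpow_nat_inv_pow w two_ne_zero
  exact_mod_cast h

/-- `S(z)² = β² + z²`. [folklore] -/
theorem bigBC_sq (β : ℝ) (z : ℂ) : bigBC β z ^ 2 = (β : ℂ) ^ 2 + z ^ 2 := sqrt_sq_eq _

/-- `Re √w = √((‖w‖ + Re w)/2)`. [folklore] -/
theorem sqrt_re (w : ℂ) : (Complex.sqrt w).re = Real.sqrt ((‖w‖ + w.re) / 2) := by
  rw [Complex.sqrt, Complex.cpow_inv_two_re]

/-- `Re √w ≥ √(Re w)`. [folklore] -/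
theorem sqrt_re_ge (w : ℂ) : Real.sqrt w.re ≤ (Complex.sqrt w).re := by
  rw [sqrt_re]
  refine Real.sqrt_le_sqrt ?_
  have := Complex.re_le_norm w
  linarith

/-- On the strip `Re S(z) > 0`. [folklore] -/
theorem bigBC_re_pos {β : ℝ} {z : ℂ} (hz : |z.im| < β) : 0 < (bigBC β z).re :=
  (Real.sqrt_pos.2 (re_radicand_pos hz)).trans_le (sqrt_re_ge _)

/-- On the strip `S(z) ≠ 0`. [folklore] -/
theorem bigBC_ne_zero {β : ℝ} {z : ℂ} (hz : |z.im| < β) : bigBC β z ≠ 0 := fun h => by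
  have := bigBC_re_pos hz
  rw [h, Complex.zero_re] at this
  exact lt_irrefl _ this

/-- `S(z)` lies in the slit plane. [folklore] -/
theorem bigBC_mem_slitPlane {β : ℝ} {z : ℂ} (hz : |z.im| < β) : bigBC β z ∈ slitPlane :=
  Or.inl (bigBC_re_pos hz)

/-- `(S - z)(S + z) = β²`. [folklore] -/
theorem bigBC_sub_mul_add (β : ℝ) (z : ℂ) : (bigBC β z - z) * (bigBC β z + z) = (β : ℂ) ^ 2 := by
  have h := bigBC_sq β z
  linear_combination h

/-- On the strip `Re(z + S(z)) > 0`. [folklore] -/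
theorem re_add_bigBC_pos {β : ℝ} {z : ℂ} (hz : |z.im| < β) : 0 < (z + bigBC β z).re := by
  have hS := bigBC_re_pos hz
  have hβ : 0 < β := (abs_nonneg _).trans_lt hz
  rcases le_or_gt 0 z.re with h | h
  · rw [Complex.add_re]; linarith
  · -- `z + S = β²/(S - z)` and `Re(S - z) > 0`
    have hd : 0 < (bigBC β z - z).re := by rw [Complex.sub_re]; linarith
    have hne : bigBC β z - z ≠ 0 := fun h0 => by rw [h0, Complex.zero_re] at hd; exact lt_irrefl _ hd
    have heq : z + bigBC β z = (β : ℂ) ^ 2 * (bigBC β z - z)⁻¹ := by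
      rw [eq_mul_inv_iff_mul_eq₀ hne, add_comm, mul_comm]
      exact bigBC_sub_mul_add β z
    rw [heq, show ((β : ℂ) ^ 2) = ((β ^ 2 : ℝ) : ℂ) by push_cast; rfl, Complex.re_ofReal_mul,
      Complex.inv_re]
    exact mul_pos (by positivity) (div_pos hd (Complex.normSq_pos.2 hne))

/-- `(z + S(z))/β` lies in the slit plane (`β > 0`, `|Im z| < β`). [folklore] -/
theorem add_bigBC_div_mem_slitPlane {β : ℝ} {z : ℂ} (hz : |z.im| < β) :
    (z + bigBC β z) / β ∈ slitPlane := by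
  have hβ : 0 < β := (abs_nonneg _).trans_lt hz
  refine Or.inl ?_
  rw [Complex.div_ofReal_re]
  exact div_pos (re_add_bigBC_pos hz) hβ

/-- `z + S(z) ≠ 0` on the strip. [folklore] -/
theorem add_bigBC_ne_zero {β : ℝ} {z : ℂ} (hz : |z.im| < β) : z + bigBC β z ≠ 0 := fun h => by
  have := re_add_bigBC_pos hz
  rw [h, Complex.zero_re] at this
  exact lt_irrefl _ this

/-! ### Values on the real axis -/

/-- `S(x) = B(x)` for real `x`. [folklore] -/
theorem bigBC_ofReal (β x : ℝ) : bigBC β x = (bigB β x : ℂ) := by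
  rw [bigBC, bigB, show ((β : ℂ) ^ 2 + (x : ℂ) ^ 2) = ((β ^ 2 + x ^ 2 : ℝ) : ℂ) by push_cast; rfl,
    Complex.sqrt_of_nonneg (Complex.zero_le_real.2 (by positivity)), Complex.ofReal_re]

/-- `τ(x) = arsinh(x/β)` for real `x` (`β > 0`). [folklore] -/
theorem saddleRC_ofReal {β : ℝ} (hβ : 0 < β) (x : ℝ) : saddleRC β x = (saddleR β x : ℂ) := by
  have hB := bigB_pos hβ x
  have hxB : 0 < x + bigB β x := by
    have := abs_le_bigB β x
    have hx : -x ≤ |x| := neg_le_abs x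
    rcases lt_or_ge 0 (x + bigB β x) with h | h
    · exact h
    · -- `x + B = 0` would force `B = -x = |x|`, contradicting `B² = β² + x² > x²`
      exfalso
      have hBx : bigB β x = -x := by linarith
      have := bigB_sq β x
      rw [hBx] at this
      nlinarith
  rw [saddleRC, bigBC_ofReal, show ((x : ℂ) + (bigB β x : ℂ)) / (β : ℂ) = (((x + bigB β x) / β : ℝ) : ℂ) by
    push_cast; rfl, ← Complex.ofReal_log (by positivity)]
  congr 1
  rw [saddleR, Real.arsinh]
  congr 1
  have h1 : Real.sqrt (1 + (x / β) ^ 2) = bigB β x / β := by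
    rw [bigB, eq_div_iff hβ.ne']
    have : (1 + (x / β) ^ 2) = (β ^ 2 + x ^ 2) / β ^ 2 := by field_simp
    rw [this, Real.sqrt_div' _ (sq_nonneg β), Real.sqrt_sq hβ.le]
    field_simp
  rw [h1]
  field_simp

/-- `F(x)` is the real saddle exponent for real `x`. [folklore] -/
theorem expoC_ofReal {β : ℝ} (hβ : 0 < β) (x : ℝ) : expoC β x = (expo β x : ℂ) := by
  rw [expoC, bigBC_ofReal, saddleRC_ofReal hβ, expo]
  push_cast
  ring

/-- The complex integrand at real `z = x` is the real integrand. [folklore] -/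
theorem ampIntegrandC_ofReal (β x θ : ℝ) :
    ampIntegrandC β x θ = ((Real.exp (-(bigB β x) * (1 - Real.cos θ)) * Real.cos (x * (θ - Real.sin θ)) : ℝ) : ℂ) := by
  rw [ampIntegrandC, bigBC_ofReal]
  push_cast
  rw [← Complex.ofReal_neg, ← Complex.ofReal_one, ← Complex.ofReal_cos θ, ← Complex.ofReal_sub,
    ← Complex.ofReal_mul, ← Complex.ofReal_exp, ← Complex.ofReal_sin, ← Complex.ofReal_sub,
    ← Complex.ofReal_mul, ← Complex.ofReal_cos]

/-- `ampC β x = amp β x` for real `x`. [folklore] -/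
theorem ampC_ofReal (β x : ℝ) : ampC β x = (amp β x : ℂ) := by
  rw [ampC, amp]
  simp_rw [ampIntegrandC_ofReal]
  rw [intervalIntegral.integral_ofReal]
  push_cast
  ring

/-- **The continuation restricts to the real interpolation**: `besselInterpC β x = besselInterp β x`.
[cite: FrohlichSpencerKT1981, App. B (B.14)] -/
theorem besselInterpC_ofReal {β : ℝ} (hβ : 0 < β) (x : ℝ) : besselInterpC β x = (besselInterp β x : ℂ) := by
  rw [besselInterpC, expoC_ofReal hβ, ampC_ofReal, besselInterp, Complex.ofReal_mul, Complex.ofReal_exp]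

/-- In particular the continuation takes the value `I_n(β)` at the integers. [cite: FrohlichSpencerKT1981, §6 property (a)] -/
theorem besselInterpC_intCast {β : ℝ} (hβ : 0 < β) (n : ℤ) : besselInterpC β n = (besselI n β : ℂ) := by
  rw [show ((n : ℂ)) = ((n : ℝ) : ℂ) by norm_cast, besselInterpC_ofReal hβ, besselInterp_intCast hβ]

/-! ### Complex derivatives of the saddle functions -/

/-- `S' = z/S` on the strip. [folklore] -/
theorem hasDerivAt_bigBC {β : ℝ} {z : ℂ} (hz : |z.im| < β) :
    HasDerivAt (bigBC β) (z / bigBC β z) z := by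
  have hslit := radicand_mem_slitPlane hz
  have hw0 := radicand_ne_zero hz
  have hS0 := bigBC_ne_zero hz
  have h1 : HasDerivAt (fun w : ℂ => (β : ℂ) ^ 2 + w ^ 2) (2 * z) z := by
    simpa using (hasDerivAt_pow 2 z).const_add ((β : ℂ) ^ 2)
  have h2 := h1.cpow_const (c := (2⁻¹ : ℂ)) hslit
  have hfun : (fun w : ℂ => ((β : ℂ) ^ 2 + w ^ 2) ^ (2⁻¹ : ℂ)) = bigBC β := rfl
  rw [hfun] at h2
  refine h2.congr_deriv ?_
  -- `2⁻¹ (β² + z²)^{2⁻¹ - 1} (2z) = z / S`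
  have hpow : ((β : ℂ) ^ 2 + z ^ 2) ^ ((2⁻¹ : ℂ) - 1) = bigBC β z / ((β : ℂ) ^ 2 + z ^ 2) := by
    rw [Complex.cpow_sub _ _ hw0, Complex.cpow_one]
    rfl
  rw [hpow]
  have hsq := bigBC_sq β z
  rw [← hsq]
  field_simp

/-- `τ' = 1/S` on the strip. [folklore] -/
theorem hasDerivAt_saddleRC {β : ℝ} {z : ℂ} (hz : |z.im| < β) :
    HasDerivAt (saddleRC β) (bigBC β z)⁻¹ z := by
  have hβ : 0 < β := (abs_nonneg _).trans_lt hz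
  have hβ0 : (β : ℂ) ≠ 0 := by exact_mod_cast hβ.ne'
  have hS0 := bigBC_ne_zero hz
  have hsum0 := add_bigBC_ne_zero hz
  have h1 : HasDerivAt (fun w : ℂ => (w + bigBC β w) / β) ((1 + z / bigBC β z) / β) z :=
    ((hasDerivAt_id z).add (hasDerivAt_bigBC hz)).div_const _
  have h2 := h1.clog (add_bigBC_div_mem_slitPlane hz)
  have hfun : (fun w : ℂ => Complex.log ((w + bigBC β w) / β)) = saddleRC β := rfl
  rw [hfun] at h2
  refine h2.congr_deriv ?_
  field_simp
  ring

/-- **`F' = -τ`** on the strip (the saddle identity `S' - τ - z τ' = -τ`). [cite: FrohlichSpencerKT1981, App. B (B.12)–(B.13)] -/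
theorem hasDerivAt_expoC {β : ℝ} {z : ℂ} (hz : |z.im| < β) :
    HasDerivAt (expoC β) (-saddleRC β z) z := by
  have hS0 := bigBC_ne_zero hz
  have h : HasDerivAt (fun w : ℂ => bigBC β w - w * saddleRC β w)
      (z / bigBC β z - (1 * saddleRC β z + z * (bigBC β z)⁻¹)) z :=
    (hasDerivAt_bigBC hz).sub ((hasDerivAt_id z).mul (hasDerivAt_saddleRC hz))
  have hfun : (fun w : ℂ => bigBC β w - w * saddleRC β w) = expoC β := rfl
  rw [hfun] at h
  refine h.congr_deriv ?_
  field_simp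
  ring

/-- `F'' = -1/S` on the strip. [cite: FrohlichSpencerKT1981, App. B (B.13)] -/
theorem hasDerivAt_neg_saddleRC {β : ℝ} {z : ℂ} (hz : |z.im| < β) :
    HasDerivAt (fun w => -saddleRC β w) (-(bigBC β z)⁻¹) z :=
  (hasDerivAt_saddleRC hz).neg

/-! ### Elementary complex bounds -/

/-- `‖cos w‖ ≤ e^{|Im w|}`. [folklore] -/
theorem norm_cos_le_exp_abs_im (w : ℂ) : ‖Complex.cos w‖ ≤ Real.exp |w.im| := by
  have h2 : (2 : ℂ) * Complex.cos w = Complex.exp (w * I) + Complex.exp (-w * I) := Complex.two_cos w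
  have hn : ‖(2 : ℂ) * Complex.cos w‖ ≤ Real.exp |w.im| + Real.exp |w.im| := by
    rw [h2]
    refine (norm_add_le _ _).trans (add_le_add ?_ ?_)
    · rw [Complex.norm_exp]
      refine Real.exp_le_exp.2 ?_
      simp only [Complex.mul_re, Complex.I_re, Complex.I_im, mul_zero, mul_one, zero_sub]
      exact neg_le_abs _
    · rw [Complex.norm_exp]
      refine Real.exp_le_exp.2 ?_
      simp only [Complex.mul_re, Complex.neg_re, Complex.neg_im, Complex.I_re, Complex.I_im, mul_zero,
        mul_one, zero_sub, neg_neg]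
      exact le_abs_self _
  rw [norm_mul, Complex.norm_ofNat] at hn
  linarith

/-- `‖sin w‖ ≤ e^{|Im w|}`. [folklore] -/
theorem norm_sin_le_exp_abs_im (w : ℂ) : ‖Complex.sin w‖ ≤ Real.exp |w.im| := by
  have h2 : (2 : ℂ) * Complex.sin w = (Complex.exp (-w * I) - Complex.exp (w * I)) * I := Complex.two_sin w
  have hn : ‖(2 : ℂ) * Complex.sin w‖ ≤ Real.exp |w.im| + Real.exp |w.im| := by
    rw [h2, norm_mul, Complex.norm_I, mul_one]
    refine (norm_sub_le _ _).trans (add_le_add ?_ ?_)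
    · rw [Complex.norm_exp]
      refine Real.exp_le_exp.2 ?_
      simp only [Complex.mul_re, Complex.neg_re, Complex.neg_im, Complex.I_re, Complex.I_im, mul_zero,
        mul_one, zero_sub, neg_neg]
      exact le_abs_self _
    · rw [Complex.norm_exp]
      refine Real.exp_le_exp.2 ?_
      simp only [Complex.mul_re, Complex.I_re, Complex.I_im, mul_zero, mul_one, zero_sub]
      exact neg_le_abs _
  rw [norm_mul, Complex.norm_ofNat] at hn
  linarith

/-- `‖e^{-S(z) u}‖ ≤ 1` for `u ≥ 0` on the strip. [folklore] -/
theorem norm_exp_neg_bigBC_mul_le {β : ℝ} {z : ℂ} (hz : |z.im| < β) {u : ℝ} (hu : 0 ≤ u) :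
    ‖Complex.exp (-(bigBC β z) * (u : ℂ))‖ ≤ 1 := by
  rw [Complex.norm_exp, Real.exp_le_one_iff]
  simp only [Complex.mul_re, Complex.neg_re, Complex.neg_im, Complex.ofReal_re, Complex.ofReal_im,
    mul_zero, sub_zero]
  have := bigBC_re_pos hz
  nlinarith

/-- `‖S(z)‖² ≥ β² - (Im z)²` on the strip. [folklore] -/
theorem sq_sub_sq_le_norm_bigBC_sq {β : ℝ} (z : ℂ) :
    β ^ 2 - z.im ^ 2 ≤ ‖bigBC β z‖ ^ 2 := by
  have h : ‖bigBC β z‖ ^ 2 = ‖(β : ℂ) ^ 2 + z ^ 2‖ := by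
    rw [← norm_pow, bigBC_sq]
  rw [h]
  refine le_trans ?_ (Complex.re_le_norm _)
  rw [re_radicand]
  nlinarith [sq_nonneg z.re]

/-! ### Differentiation of the amplitude under the integral sign -/

/-- The `z`-derivative of the complex integrand:
`e^{-S u} ( -(z/S) u cos(z v) - v sin(z v) )`, `u = 1 - cos θ`, `v = θ - sin θ`. [folklore] -/
def ampIntegrandCD1 (β : ℝ) (z : ℂ) (θ : ℝ) : ℂ :=
  Complex.exp (-(bigBC β z) * ((1 - Real.cos θ : ℝ) : ℂ)) *
    (-(z / bigBC β z) * ((1 - Real.cos θ : ℝ) : ℂ) * Complex.cos (z * ((θ - Real.sin θ : ℝ) : ℂ))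
      - ((θ - Real.sin θ : ℝ) : ℂ) * Complex.sin (z * ((θ - Real.sin θ : ℝ) : ℂ)))

/-- `∂_z ampIntegrandC = ampIntegrandCD1` on the strip. [folklore] -/
theorem hasDerivAt_ampIntegrandC {β : ℝ} {z : ℂ} (hz : |z.im| < β) (θ : ℝ) :
    HasDerivAt (fun w => ampIntegrandC β w θ) (ampIntegrandCD1 β z θ) z := by
  have hB := hasDerivAt_bigBC hz
  have he : HasDerivAt (fun w => Complex.exp (-(bigBC β w) * ((1 - Real.cos θ : ℝ) : ℂ)))
      (Complex.exp (-(bigBC β z) * ((1 - Real.cos θ : ℝ) : ℂ)) * (-(z / bigBC β z) * ((1 - Real.cos θ : ℝ) : ℂ))) z :=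
    (hB.neg.mul_const _).cexp
  have hc : HasDerivAt (fun w : ℂ => Complex.cos (w * ((θ - Real.sin θ : ℝ) : ℂ)))
      (-Complex.sin (z * ((θ - Real.sin θ : ℝ) : ℂ)) * (1 * ((θ - Real.sin θ : ℝ) : ℂ))) z :=
    ((hasDerivAt_id z).mul_const _).ccos
  have h : HasDerivAt (fun w => ampIntegrandC β w θ)
      (Complex.exp (-(bigBC β z) * ((1 - Real.cos θ : ℝ) : ℂ)) * (-(z / bigBC β z) * ((1 - Real.cos θ : ℝ) : ℂ)) *
          Complex.cos (z * ((θ - Real.sin θ : ℝ) : ℂ)) +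
        Complex.exp (-(bigBC β z) * ((1 - Real.cos θ : ℝ) : ℂ)) *
          (-Complex.sin (z * ((θ - Real.sin θ : ℝ) : ℂ)) * (1 * ((θ - Real.sin θ : ℝ) : ℂ)))) z :=
    he.mul hc
  refine h.congr_deriv ?_
  simp only [ampIntegrandCD1]
  ring

/-- Continuity of the integrand in `θ`. [folklore] -/
@[fun_prop] theorem continuous_ampIntegrandC (β : ℝ) (z : ℂ) : Continuous (ampIntegrandC β z) := by
  unfold ampIntegrandC; fun_prop

/-- Continuity of the derivative integrand in `θ`. [folklore] -/
@[fun_prop] theorem continuous_ampIntegrandCD1 (β : ℝ) (z : ℂ) : Continuous (ampIntegrandCD1 β z) := by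
  unfold ampIntegrandCD1; fun_prop

/-- A crude uniform bound on the derivative integrand near a point of the strip: for
`|Im w| ≤ b < β`, `‖w‖ ≤ R` and `|θ| ≤ π`,
`‖∂_z F(w, θ)‖ ≤ (R/√(β² - b²) · 2 + (π + 1)) e^{b(π+1)}`. [folklore] -/
theorem norm_ampIntegrandCD1_le {β b R : ℝ} (hb : b < β) {w : ℂ} (hw : |w.im| ≤ b) (hwR : ‖w‖ ≤ R)
    {θ : ℝ} (hθ : |θ| ≤ π) :
    ‖ampIntegrandCD1 β w θ‖ ≤ (R / Real.sqrt (β ^ 2 - b ^ 2) * 2 + (π + 1)) * Real.exp (b * (π + 1)) := by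
  have hb0 : 0 ≤ b := (abs_nonneg _).trans hw
  have hwβ : |w.im| < β := hw.trans_lt hb
  have hgap : 0 < β ^ 2 - b ^ 2 := by nlinarith
  have hS0 := bigBC_ne_zero hwβ
  -- the pieces
  have hu0 : 0 ≤ 1 - Real.cos θ := by linarith [Real.cos_le_one θ]
  have hu2 : 1 - Real.cos θ ≤ 2 := by linarith [Real.neg_one_le_cos θ]
  have hv : |θ - Real.sin θ| ≤ π + 1 := by
    calc |θ - Real.sin θ| ≤ |θ| + |Real.sin θ| := abs_sub _ _
      _ ≤ π + 1 := add_le_add hθ (Real.abs_sin_le_one θ)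
  have hexp := norm_exp_neg_bigBC_mul_le hwβ hu0
  have hzS : ‖w / bigBC β w‖ ≤ R / Real.sqrt (β ^ 2 - b ^ 2) := by
    rw [norm_div]
    have hSn : Real.sqrt (β ^ 2 - b ^ 2) ≤ ‖bigBC β w‖ := by
      rw [Real.sqrt_le_left (norm_nonneg _)]
      refine le_trans ?_ (sq_sub_sq_le_norm_bigBC_sq w)
      have : w.im ^ 2 ≤ b ^ 2 := by
        rw [← sq_abs]; exact pow_le_pow_left₀ (abs_nonneg _) hw 2
      linarith
    have hSpos : 0 < Real.sqrt (β ^ 2 - b ^ 2) := Real.sqrt_pos.2 hgap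
    exact div_le_div₀ ((norm_nonneg _).trans hwR) hwR hSpos hSn
  have him : ∀ r : ℝ, |(w * (r : ℂ)).im| ≤ b * |r| := fun r => by
    rw [Complex.mul_im, Complex.ofReal_re, Complex.ofReal_im, mul_zero, zero_add, abs_mul]
    exact mul_le_mul_of_nonneg_right hw (abs_nonneg _)
  have hcos : ‖Complex.cos (w * ((θ - Real.sin θ : ℝ) : ℂ))‖ ≤ Real.exp (b * (π + 1)) := by
    refine (norm_cos_le_exp_abs_im _).trans (Real.exp_le_exp.2 ?_)
    exact (him _).trans (mul_le_mul_of_nonneg_left hv hb0)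
  have hsin : ‖Complex.sin (w * ((θ - Real.sin θ : ℝ) : ℂ))‖ ≤ Real.exp (b * (π + 1)) := by
    refine (norm_sin_le_exp_abs_im _).trans (Real.exp_le_exp.2 ?_)
    exact (him _).trans (mul_le_mul_of_nonneg_left hv hb0)
  have hun : ‖((1 - Real.cos θ : ℝ) : ℂ)‖ ≤ 2 := by
    rw [Complex.norm_real, Real.norm_eq_abs, abs_of_nonneg hu0]; exact hu2
  have hvn : ‖((θ - Real.sin θ : ℝ) : ℂ)‖ ≤ π + 1 := by
    rw [Complex.norm_real, Real.norm_eq_abs]; exact hv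
  have hE : 0 ≤ Real.exp (b * (π + 1)) := Real.exp_nonneg _
  have hRS : 0 ≤ R / Real.sqrt (β ^ 2 - b ^ 2) := div_nonneg ((norm_nonneg _).trans hwR) (Real.sqrt_nonneg _)
  rw [ampIntegrandCD1, norm_mul]
  calc ‖Complex.exp (-(bigBC β w) * ((1 - Real.cos θ : ℝ) : ℂ))‖ *
        ‖-(w / bigBC β w) * ((1 - Real.cos θ : ℝ) : ℂ) * Complex.cos (w * ((θ - Real.sin θ : ℝ) : ℂ))
          - ((θ - Real.sin θ : ℝ) : ℂ) * Complex.sin (w * ((θ - Real.sin θ : ℝ) : ℂ))‖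
      ≤ 1 * (R / Real.sqrt (β ^ 2 - b ^ 2) * 2 * Real.exp (b * (π + 1)) + (π + 1) * Real.exp (b * (π + 1))) := by
        refine mul_le_mul hexp ?_ (norm_nonneg _) zero_le_one
        refine (norm_sub_le _ _).trans (add_le_add ?_ ?_)
        · rw [norm_mul, norm_mul, norm_neg]
          exact mul_le_mul (mul_le_mul hzS hun (norm_nonneg _) hRS) hcos (norm_nonneg _) (by positivity)
        · rw [norm_mul]
          exact mul_le_mul hvn hsin (norm_nonneg _) (by positivity)
    _ = (R / Real.sqrt (β ^ 2 - b ^ 2) * 2 + (π + 1)) * Real.exp (b * (π + 1)) := by ring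

/-- `amp'`, complex: `ampCD1 β z = (2π)⁻¹ ∫ ∂_z F`. [folklore] -/
def ampCD1 (β : ℝ) (z : ℂ) : ℂ := ((2 * π : ℝ) : ℂ)⁻¹ * ∫ θ in (-π)..π, ampIntegrandCD1 β z θ

/-- **`ampC` is complex-differentiable on the strip `|Im z| < β`, with derivative `ampCD1`**
(differentiation under the integral sign, dominated by a constant on a small disc). [folklore] -/
theorem hasDerivAt_ampC {β : ℝ} {z : ℂ} (hz : |z.im| < β) : HasDerivAt (ampC β) (ampCD1 β z) z := by
  -- a disc around `z` inside the strip `|Im| ≤ b`, `b = (β + |Im z|)/2`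
  set r : ℝ := (β - |z.im|) / 2 with hr
  have hrpos : 0 < r := by rw [hr]; linarith
  set b : ℝ := (β + |z.im|) / 2 with hbdef
  have hb : b < β := by rw [hbdef]; linarith
  have hball : ∀ w ∈ Metric.ball z r, |w.im| ≤ b ∧ ‖w‖ ≤ ‖z‖ + r := by
    intro w hw
    rw [Metric.mem_ball, dist_eq_norm] at hw
    constructor
    · have h1 : |w.im - z.im| ≤ ‖w - z‖ := by
        simpa [Complex.sub_im] using Complex.abs_im_le_norm (w - z)
      have h2 : |w.im| ≤ |z.im| + |w.im - z.im| := by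
        have := abs_add_le (z.im) (w.im - z.im); simpa using this
      rw [hbdef]; linarith
    · have := norm_le_norm_add_norm_sub' w z  -- ‖w‖ ≤ ‖z‖ + ‖w - z‖
      linarith [norm_sub_rev w z]
  have hle : -π ≤ π := by linarith [Real.pi_pos]
  set M : ℝ := ((‖z‖ + r) / Real.sqrt (β ^ 2 - b ^ 2) * 2 + (π + 1)) * Real.exp (b * (π + 1)) with hM
  have key := intervalIntegral.hasDerivAt_integral_of_dominated_loc_of_deriv_le
    (μ := volume) (a := -π) (b := π) (x₀ := z) (s := Metric.ball z r)
    (F := fun w θ => ampIntegrandC β w θ) (F' := fun w θ => ampIntegrandCD1 β w θ)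
    (bound := fun _ => M)
    (Metric.ball_mem_nhds z hrpos)
    (Eventually.of_forall fun w => (continuous_ampIntegrandC β w).aestronglyMeasurable)
    ((continuous_ampIntegrandC β z).intervalIntegrable _ _)
    (continuous_ampIntegrandCD1 β z).aestronglyMeasurable
    (ae_of_all _ fun θ hθ w hw => by
      have habs : |θ| ≤ π := by
        rw [Set.uIoc_of_le hle] at hθ
        exact abs_le.2 ⟨hθ.1.le, hθ.2⟩
      obtain ⟨hwb, hwR⟩ := hball w hw
      exact norm_ampIntegrandCD1_le hb hwb hwR habs)
    intervalIntegrable_const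
    (ae_of_all _ fun θ _ w hw => hasDerivAt_ampIntegrandC ((hball w hw).1.trans_lt hb) θ)
  exact key.2.const_mul _

/-- `F` and hence `I_β` are complex-differentiable on the strip. [folklore] -/
theorem hasDerivAt_besselInterpC {β : ℝ} {z : ℂ} (hz : |z.im| < β) :
    HasDerivAt (besselInterpC β)
      (Complex.exp (expoC β z) * (-saddleRC β z) * ampC β z + Complex.exp (expoC β z) * ampCD1 β z) z :=
  (hasDerivAt_expoC hz).cexp.mul (hasDerivAt_ampC hz)

/-- The strip `|Im z| < β` is open. [folklore] -/
theorem isOpen_strip (β : ℝ) : IsOpen {z : ℂ | |z.im| < β} :=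
  isOpen_lt (continuous_abs.comp Complex.continuous_im) continuous_const

/-- **Analyticity of the continuation `I_β(z)` on the strip `|Im z| < β`.**
[cite: FrohlichSpencerKT1981, §6 p. 576 ("complex analytic in the strip")] -/
theorem differentiableOn_besselInterpC (β : ℝ) :
    DifferentiableOn ℂ (besselInterpC β) {z : ℂ | |z.im| < β} := fun _ hz =>
  (hasDerivAt_besselInterpC (β := β) hz).differentiableAt.differentiableWithinAt

/-- The same, as analyticity on a neighbourhood of each point of the strip. [cite: FrohlichSpencerKT1981, §6 p. 576] -/
theorem analyticOnNhd_besselInterpC (β : ℝ) :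
    AnalyticOnNhd ℂ (besselInterpC β) {z : ℂ | |z.im| < β} :=
  (differentiableOn_besselInterpC β).analyticOnNhd (isOpen_strip β)

end BesselInterp

end Literature.Probability.LatticeModels
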